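import Summits.QuantumFields.YangMills.Theorems.AlphaInputsT3ACv2RecHistories
import Summits.QuantumFields.YangMills.Theorems.UnitScaleTiltFluctuationComparisonRegPrRestrictedUpperStep
import Summits.QuantumFields.Balaban3D.Proofs.WindowAC
import Summits.QuantumFields.Balaban3D.Proofs.TrivMassAC
import Literature.MathematicalPhysics.QuantumFieldTheory.Balaban1983to89.BlockAveragingPlaquetteBound
import Literature.MathematicalPhysics.QuantumFieldTheory.Balaban1983to89.T3ThresholdSmallness
import HarnessLib

/-!
# `AlphaInputsT3ACv2RecWindow` — THE WINDOWED TRIVIAL WEIGHT the frozen v2 package delivers for the concrete datum `OfV2At.dataT3c` (crux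
# `HistoryTailL` = stmt-QuantumFields-19936 of route `UnitScaleTilt`, line v5p3, STUB 2‴ `stub_windowedTrivialWeight` — the derivable part, with the
# stub's three located mis-statements recorded)

Lane `pub-balaban3d`, seat alpha-1 (g3).  THE CONSUMER'S ASK (v5p3 STUB 2‴, lead finding F-g3-2): the concrete datum's trivial history carries the
lane's FLOORED mass `≥ 1` at every datum (`lfDataT3c_one_le_wt_trivReg`), so `up_{dataT3c}` charges every large-plaquette event; wanted: a trivial
weight `wt′` (i) supported a.e. in the charged window `Adm … triv`, (ii) with `∫ wt′ ≤ 2`, (iii) the non-trivial masses supported a.e. on their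
admissible pairs, (iv) (41′) a.e. + integrability for the datum with `LF` replaced by `wt′·e^{Φ(triv)} + Σ_{r ≠ triv} m·e^{Φ(r)}`.

WHAT THIS FILE DELIVERS (conditional on the package `OfV2At F 𝔠 a₀ a₁`, nothing of [Balaban1985UV3] asserted): the weight
`wtW K j` := `1` at `j = 0`, and at `j = k + 1` the WINDOWED RAW TRANSPORT `𝟙_{Wn}·T_k[m_k(triv)]` (`TrivMassAC.trivWt`) with the window
`Wn = {all level-(k+1) plaquettes within avgWindowFactor(L)·θBal(K − k) of 1}` — and, for `γ ≤ γwOf L b₀ p₀` (the threshold making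
`(25L²/4)·θBal < δ_{SU(2)}` at every height, `T3ThresholdSmallness.exists_forall_θBal_le`):
* `wtW ≥ 0`, `wtW ≤` the lane's trivial weight (pointwise), `wtW` integrable with `∫ wtW K j ≤ max j 1` (§2);
* (i′) FOR `1 ≤ j ≤ K`, POINTWISE: `wtW K j W ≠ 0 ⇒ Adm K j triv W` (the window sits inside print's (40) window `2L²·avgWindowFactor·θBal(K−j+1)`,
  `θBal(K−j+1) ≥ θBal(K−j)/(2L²)`) (§2);
* §0 (lane-generic, any scales / AC inputs) `WindowStep.ineq41_windowed_succ_ae`: the (41) step with the trivial history's weight WINDOWED and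
  UNFLOORED at the top, from `WindowAC.transport_rho_le_windowed_ae`, the nine residual leaves (exponent bookkeeping per history,
  `RepAtHeightsAdapter.expo5558_le_expo41_succ`) and the honesty of the version selection;
* §3 the windowed datum `dataT3cW` = `dataT3c` with `LF` replaced as the stub writes it, its majorant unfolded and `0 ≤ up_{dataT3cW} ≤ up_{dataT3c}`;
  the (41′) a.e. + integrability of `up_{dataT3cW}` at every `j ≤ K` (from `WindowAC.ineq41_windowed_succ_ae`) and the bundle in the stub's
  quantifier order are the sequel file `AlphaInputsT3ACv2RecWindowIneq`.

THE THREE LOCATED MIS-STATEMENTS OF STUB 2‴ (seat findings, numbers in the lane's NOTES/STATUS):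
F-α1-9 — clause (i) at `j = 0` contradicts (iv): `Hist (F.P K) 0 = {triv}` and `resDensity K univ 0 = e^{−β_K A} > 0`, so (iv) forces
  `wt′ K 0 > 0` a.e. while (i) forces `wt′ K 0 = 0` a.e. off a window of positive co-measure; print's (41)₀ = (1) p.256 has no `χ`.  Hence `1 ≤ j` in (i′).
F-α1-10 — clause (iii) is not derivable for the lane's masses and false in general: `m_{k+1}(h′) = T_k[w_k(h′)·m_k(proj h′)]` (`MassesAC.massRecAC_succ`)
  with `w_k(h′)` constraining the field only on `P_k(h′)` and on the RING `Λ_k(h′) = Ω_k ∖ Ω_{k+1}(h′)` (`Carriers.stepWeight`); the small-field factor on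
  `B(Λ_{k+1}) = Ω_{k+1}(h′)` (`Bound55Masses.chiB`) sits on the left of `Fibre49AC` only.  Delivering (iii) needs windowed masses for ALL histories,
  hence a LOCAL form of [Balaban1985Averaging] Prop. 1 (tree: global form only) and the residual in mass-generic form.
F-α1-11 — clause (ii) `∫ wt′ ≤ 2` uniformly in the cut-off is not derivable: `Fibre49AC` is stated for the FLOORED masses, so the windowed weight it
  yields is `𝟙_{Wn}·T_k[m_k(triv)]`, and the floors below compound, `∫ m_k(triv) ≤ k + 1` (`TrivMassAC.integral_massRecAC_triv_le`); `K`-uniformity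
  needs the unfloored chain `χ·T_k[χ·T_{k−1}[⋯]]` (`∫ ≤ 1`), whose (41) needs the (β) residual with that chain in place of `m(triv)` — a kernel-form
  R3D-01, not in the v2 package.

References: T. Bałaban, Commun. Math. Phys. 102 (1985) 255–275 [Balaban1985UV3] ((1) p.256, (40)–(41) p.266, (47) p.267, (48)–(49) pp.267–268,
(55) p.269); Commun. Math. Phys. 98 (1985) 17–51 [Balaban1985Averaging] (Prop. 1 (51) p.26).
-/

set_option autoImplicit false

noncomputable section

namespace Summit.QuantumFields.YangMills.Theorems

open MeasureTheory
open Literature.MathematicalPhysics.QuantumFieldTheory.Balaban1983to89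
open Literature.MathematicalPhysics.QuantumFieldTheory.Balaban1983to89.AveragingRT (rnTransport rnTransport_nonneg)
open Literature.MathematicalPhysics.QuantumFieldTheory.Balaban1983to89.T3ContinuumYM3Torus
open Literature.MathematicalPhysics.QuantumFieldTheory.Balaban1983to89.T3UnitLawDensityEML (ℰp)
open Literature.MathematicalPhysics.QuantumFieldTheory.Balaban1983to89.T3UnitScaleTilt (θBal measurableSet_plaqSmall)
open Literature.MathematicalPhysics.QuantumFieldTheory.Balaban1983to89.T3ThresholdSmallness (exists_forall_θBal_le)
open Literature.MathematicalPhysics.QuantumFieldTheory.Balaban1983to89.T3RestrictedUnitDensity (resDensity)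
open Literature.MathematicalPhysics.QuantumFieldTheory.Balaban1983to89.T3AlphaInputsAC
open Literature.MathematicalPhysics.QuantumFieldTheory.Balaban1983to89.ExpMeanLog (deltaSU deltaSU_pos)
open Literature.MathematicalPhysics.QuantumFieldTheory.Balaban1983to89.BlockAveragingPlaquetteBound (plaqSmall_blockAvg_expMeanLogSU)
open Literature.MathematicalPhysics.QuantumFieldTheory.Balaban1985CMP102
open Literature.MathematicalPhysics.QuantumFieldTheory.Balaban1985CMP102.Setting
open Summit.QuantumFields.Balaban3D.Carriers
open Summit.QuantumFields.Balaban3D.Proofs.Primitives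
open Summit.QuantumFields.Balaban3D.Proofs.TowerAC
open Summit.QuantumFields.Balaban3D.Proofs.StandardAC
open Summit.QuantumFields.Balaban3D.Proofs.InputsAC
open Summit.QuantumFields.Balaban3D.Proofs.MassesAC
open Summit.QuantumFields.Balaban3D.Proofs.TrivMassAC
open Summit.QuantumFields.Balaban3D.Proofs.WindowAC
open Summit.QuantumFields.Balaban3D.Proofs.Thm2AC (stepResidualsAC_of_alpha)
open Summit.QuantumFields.Balaban3D.Proofs.Bound55AC (hint_stdAC)
open Summit.QuantumFields.Balaban3D.Proofs.TransportAC (integrable_mul_exp_of_le)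
open Summit.QuantumFields.Balaban3D.Proofs (Bound55Std.measurable_actionEta Bound55Std.actionEta_nonneg)
open Summit.QuantumFields.Balaban3D.Proofs.Bound55Masses (chiB chiB_nonneg chiB_le_one measurable_chiB measurable_stepWeight)
open Summit.QuantumFields.Balaban3D.Proofs.Bound55AC (Fibre49AC)
open Literature.MathematicalPhysics.QuantumFieldTheory.Balaban1983to89.B10 (Ineq41)

open Classical

/-! ## §0 The lane's AC tower (any scales, any AC inputs): the (41) step with the trivial weight WINDOWED AND UNFLOORED at the top -/

namespace WindowStep

variable {P : Params} {G : Type} [GaugeGroup G]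

open Classical in
/-- **At the trivial history the `B(Λ_{k+1})`-factor is the characteristic function of ALL level-`k` plaquettes** (`Ω_{k+1}(triv) = T_η`,
`Carriers.Omega_triv`; no large-field plaquettes): `chiB(triv)(U) ≠ 0 ⇒ |U(∂p) − 1| < ε(k)` for every `p`. [cite: Balaban1985UV3, (49) p.268] -/
theorem plaqSmall_of_chiB_triv_ne_zero (M₁ : ℕ) (Rcol : ℕ → ℕ) (ε : ℕ → ℝ) (k : ℕ) (U : GaugeField P k G)
    (h : chiB M₁ Rcol ε k (Hist.triv P (k + 1)) U ≠ 0) : PlaqSmall (ε k) U := by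
  unfold chiB at h
  split_ifs at h with hc
  · intro p
    exact hc p (by simp) (by rw [Omega_triv]; exact Set.subset_univ _)
  · exact absurd rfl h

variable {L : ℕ} (𝔎 : Summit.QuantumFields.Balaban3D.Proofs.Inputs.LaneConsts L) {S : Scales L} [MeasurableSpace G] [HaarData G] [RegularGaugeGroup G]
  {E : Type} [NormedAddCommGroup E] [NormedSpace ℂ E]
  (X : ExternalInputsAC S G) (𝔖 : ∀ k, StepSeries S G E (nblkOf S 𝔎.carrier k) k) (k : ℕ)

/-- **THE (41) STEP WITH THE TRIVIAL HISTORY WINDOWED, on the lane's AC tower** (what the frozen rows of the v2 package give towards print's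
`χ_{k+1}` of (40)–(41)): given (41)_k for the tower (pointwise, the lane's `Thm2AC`), the nine residual step leaves at the AC pieces (`R`, for
the exponent bookkeeping), the integrability of the (41)_k summands (`hint`) and the (β) residual `Fibre49AC` per new history (`hfibre`), and a
measurable window `Wn` of level `k + 1` CONTAINING THE AVERAGES OF ALL `ε₁(k)`-SMALL LEVEL-`k` FIELDS (`hsmall` — [Balaban1985Averaging] Prop. 1
for the averaging at hand), then `dV`-a.e.
`ρ_{k+1}(W) ≤ 𝟙_{Wn}(W)·T_k[m_k(triv)](W)·e^{Φ_{k+1}(triv,W)} + Σ_{h′ ≠ triv} m_{k+1}(h′,W)·e^{Φ_{k+1}(h′,W)}`,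
`Φ_{k+1}(h,W) = −mainT_{k+1}(h,W) + Pint_{k+1}(h,W) − E_{k+1} + Zterm_{k+1}(h) + Rm_{k+1}` — i.e. (41)_{k+1} with the trivial weight replaced by
the WINDOWED RAW TRANSPORT `𝟙_{Wn}·T_k[m_k(triv)]` (`≤ m_{k+1}(triv) = max 1 (T_k[m_k(triv)])` pointwise).  Ingredients: `WindowAC.transport_rho_le_windowed_ae`
with the lane's step weights / `chiB` (support `plaqSmall_of_chiB_triv_ne_zero` + `hsmall`), the covering `MassesAC.massRecAC_cover`
(`ε_L(k) ≤ ε_S(k)`, `AlphaBound55.eps1Of_le_epsSOf`), `w_k(triv) ≡ 1` (`Carriers.stepWeight_triv`), `T_k[w·m] ≤ m_{k+1}` a.e. for the other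
histories (`MassesAC.transport_le_massRecAC_ae`), the per-history exponent bookkeeping `RepAtHeightsAdapter.expo5558_le_expo41_succ` (★ym-ust-19201-p1 lineage) on `Thm2AC.stepLeavesOfAC`,
and the honesty of the version selection `Carriers.run3_rho_succ_ae_eq_rn` (`ρ_{k+1} = T_kρ_k` a.e.). [cite: Balaban1985UV3, (40)–(41) p.266 + (48)–(49) pp.267–268 + (55) p.269] -/
theorem ineq41_windowed_succ_ae [DecidableEq (Hist S.P (k + 1))] (hk : k + 1 ≤ S.K)
    (h41 : Ineq41 (towerOfAC 𝔎 X 𝔖) k)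
    (R : Summit.QuantumFields.Balaban3D.Proofs.Thm2AC.StepResidualsAC 𝔎 X 𝔖 k)
    (hint : ∀ h : Hist S.P k, Integrable (fun U => (inputOfAC 𝔎 X 𝔖).W.mass k h U *
      Real.exp (-((towerWAC 𝔎 X 𝔖).mainT k h U) + (inputOfAC 𝔎 X 𝔖).Pint k h U - (towerWAC 𝔎 X 𝔖).Ecst k
        + (towerWAC 𝔎 X 𝔖).Zterm k h + (towerWAC 𝔎 X 𝔖).Rm k)) (fieldMeasure S.P k G))
    (hfibre : ∀ h' : Hist S.P (k + 1), Fibre49AC X 𝔎.carrier 𝔖 (fun _ => True) k (piecesWAC 𝔎 X 𝔖 k) h')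
    (Wn : Set (GaugeField S.P (k + 1) G)) (hWn : MeasurableSet Wn)
    (hsmall : ∀ U : GaugeField S.P k G, PlaqSmall (eps1Of S 𝔎.carrier k) U → (X.av k).avg U ∈ Wn) :
    ∀ᵐ W ∂(fieldMeasure S.P (k + 1) G), (towerOfAC 𝔎 X 𝔖).ρ (k + 1) W ≤
      Wn.indicator (fun _ => (1 : ℝ)) W *
          rnTransport (X.av k).avg ((inputOfAC 𝔎 X 𝔖).W.mass k (Hist.triv S.P k)) W *
          Real.exp (-((towerOfAC 𝔎 X 𝔖).mainT (k + 1) (Hist.triv S.P (k + 1)) W)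
            + (towerOfAC 𝔎 X 𝔖).Pint (k + 1) (Hist.triv S.P (k + 1)) W - (towerOfAC 𝔎 X 𝔖).Ecst (k + 1)
            + (towerOfAC 𝔎 X 𝔖).Zterm (k + 1) (Hist.triv S.P (k + 1)) + (towerOfAC 𝔎 X 𝔖).Rm (k + 1)) +
        ∑ h' ∈ Finset.univ.erase (Hist.triv S.P (k + 1)),
          (inputOfAC 𝔎 X 𝔖).W.mass (k + 1) h' W *
            Real.exp (-((towerOfAC 𝔎 X 𝔖).mainT (k + 1) h' W) + (towerOfAC 𝔎 X 𝔖).Pint (k + 1) h' W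
              - (towerOfAC 𝔎 X 𝔖).Ecst (k + 1) + (towerOfAC 𝔎 X 𝔖).Zterm (k + 1) h' + (towerOfAC 𝔎 X 𝔖).Rm (k + 1)) := by
  have hkm : k ≤ S.P.m + S.P.K := by show k ≤ S.m + S.K; omega
  have hLS := Summit.QuantumFields.Balaban3D.Proofs.AlphaBound55.eps1Of_le_epsSOf k 𝔎.carrier 𝔎.F.b₀_nonneg 𝔎.F.p₀_pos.le (show k ≤ S.K by omega)
  -- (41)_k for the unpinned tower
  have h41W : Ineq41 (towerWAC 𝔎 X 𝔖).toTowerRun k := ((towerWAC 𝔎 X 𝔖).ineq41_pin_iff k).mp h41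
  -- support of the trivial history's fibre factor
  have hsupp : ∀ U : GaugeField S.P k G,
      stepWeight 𝔎.carrier.M₁ (rcolOf S 𝔎.carrier) (eps1Of S 𝔎.carrier) (epsSOf S 𝔎.carrier) k (Hist.triv S.P (k + 1)) U *
        chiB 𝔎.carrier.M₁ (rcolOf S 𝔎.carrier) (eps1Of S 𝔎.carrier) k (Hist.triv S.P (k + 1)) U ≠ 0 → (X.av k).avg U ∈ Wn :=
    fun U hU => hsmall U (plaqSmall_of_chiB_triv_ne_zero _ _ _ k U (right_ne_zero_of_mul hU))
  -- the windowed (48)–(49) step on the unpinned tower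
  have hstep := transport_rho_le_windowed_ae (inputOfAC 𝔎 X 𝔖) (fun _ => True) k (piecesWAC 𝔎 X 𝔖 k) (X.av_ac k)
    (stepWeight 𝔎.carrier.M₁ (rcolOf S 𝔎.carrier) (eps1Of S 𝔎.carrier) (epsSOf S 𝔎.carrier) k)
    (chiB 𝔎.carrier.M₁ (rcolOf S 𝔎.carrier) (eps1Of S 𝔎.carrier) k)
    (measurable_stepWeight 𝔎.carrier.M₁ (rcolOf S 𝔎.carrier) (eps1Of S 𝔎.carrier) (epsSOf S 𝔎.carrier) k)
    (stepWeight_nonneg 𝔎.carrier.M₁ (rcolOf S 𝔎.carrier) (eps1Of S 𝔎.carrier) (epsSOf S 𝔎.carrier) k)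
    (stepWeight_le_one 𝔎.carrier.M₁ (rcolOf S 𝔎.carrier) (eps1Of S 𝔎.carrier) (epsSOf S 𝔎.carrier) k)
    (measurable_chiB 𝔎.carrier.M₁ (rcolOf S 𝔎.carrier) (eps1Of S 𝔎.carrier) k)
    (chiB_nonneg 𝔎.carrier.M₁ (rcolOf S 𝔎.carrier) (eps1Of S 𝔎.carrier) k)
    (chiB_le_one 𝔎.carrier.M₁ (rcolOf S 𝔎.carrier) (eps1Of S 𝔎.carrier) k)
    (massRecAC_cover 𝔎.carrier.M₁ (rcolOf S 𝔎.carrier) (eps1Of S 𝔎.carrier) (epsSOf S 𝔎.carrier) X.av k hLS)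
    hint hfibre h41W Wn hWn hsupp
  -- honesty of the version selection: `ρ_{k+1} = T_k ρ_k` a.e.
  have hρ : ∀ᵐ W ∂(fieldMeasure S.P (k + 1) G),
      (towerOfAC 𝔎 X 𝔖).ρ (k + 1) W = rnTransport (X.av k).avg ((towerWAC 𝔎 X 𝔖).rho k) W := by
    filter_upwards [run3_rho_succ_ae_eq_rn ((inputOfAC 𝔎 X 𝔖).toRunInput fun _ => True) k] with W hW
    exact (congrFun ((towerWAC 𝔎 X 𝔖).pin_rho (k + 1)) W).trans hW
  -- the new masses dominate the transported weighted old ones, a.e., every history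
  have hm₁ := ae_all_iff.mpr fun h' : Hist S.P (k + 1) =>
    transport_le_massRecAC_ae 𝔎.carrier.M₁ (rcolOf S 𝔎.carrier) (eps1Of S 𝔎.carrier) (epsSOf S 𝔎.carrier) X.av k h'
  -- exponent bookkeeping from the leaves
  have hexp := RepAtHeightsAdapter.expo5558_le_expo41_succ (Summit.QuantumFields.Balaban3D.Proofs.Thm2AC.stepLeavesOfAC k hk R) hk (Summit.QuantumFields.Balaban3D.Proofs.ScalesArithmetic.gk_pos S k)
    (Summit.QuantumFields.Balaban3D.Proofs.ScalesArithmetic.gk_le_one S S.gK_le_one k (by omega))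
  -- `w_k(triv) ≡ 1`
  have hw1 : (fun U => stepWeight 𝔎.carrier.M₁ (rcolOf S 𝔎.carrier) (eps1Of S 𝔎.carrier) (epsSOf S 𝔎.carrier) k
        (Hist.triv S.P (k + 1)) U * (inputOfAC 𝔎 X 𝔖).W.mass k (Hist.triv S.P (k + 1)).proj U) =
      (inputOfAC 𝔎 X 𝔖).W.mass k (Hist.triv S.P k) := by
    funext U
    rw [stepWeight_triv _ _ _ _ hkm, one_mul, Hist.proj_triv]
  -- two monotonicity templates (the exponents of `hstep` and of the statement agree up to unfolding `pin`/`piecesWAC`)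
  have key₁ : ∀ {a i x y : ℝ}, 0 ≤ a → 0 ≤ i → x ≤ y → a * (i * x) ≤ i * a * y := by
    intro a i x y ha hi hxy
    calc a * (i * x) = i * a * x := by ring
      _ ≤ i * a * y := mul_le_mul_of_nonneg_left hxy (mul_nonneg hi ha)
  have key₂ : ∀ {t m x y : ℝ}, t ≤ m → 0 ≤ m → 0 ≤ x → x ≤ y → t * x ≤ m * y := by
    intro t m x y htm hm hx hxy
    exact (mul_le_mul_of_nonneg_right htm hx).trans (mul_le_mul_of_nonneg_left hxy hm)
  filter_upwards [hstep, hρ, hm₁] with W hW hρW hmW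
  rw [hρW]
  refine hW.trans ?_
  rw [← Finset.add_sum_erase Finset.univ _ (Finset.mem_univ (Hist.triv S.P (k + 1)))]
  refine add_le_add ?_ (Finset.sum_le_sum fun h' hh' => ?_)
  · rw [if_pos (rfl : Hist.triv S.P (k + 1) = Hist.triv S.P (k + 1)), hw1]
    exact key₁ (rnTransport_nonneg _ _ ((inputOfAC 𝔎 X 𝔖).W.mass_nonneg k _) W)
      (Set.indicator_nonneg (fun _ _ => zero_le_one) W) (Real.exp_le_exp.mpr (hexp (Hist.triv S.P (k + 1)) W))
  · have hne : h' ≠ Hist.triv S.P (k + 1) := Finset.ne_of_mem_erase hh'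
    rw [if_neg hne, one_mul]
    exact key₂ (hmW h') ((inputOfAC 𝔎 X 𝔖).W.mass_nonneg (k + 1) h' W) (Real.exp_pos _).le
      (Real.exp_le_exp.mpr (hexp h' W))

end WindowStep

/-! ## §1 The coupling threshold `γwOf` and the window -/

/-- The target smallness `δ_{SU(2)}/(5L)²` of the thresholds is positive (`L ≥ 1`). [folklore] -/
theorem AlphaInputsT3AC.winEps_pos {L : ℕ} (hL : 1 ≤ L) : 0 < deltaSU (Fin 2) / (((3 + 2) * L : ℕ) : ℝ) ^ 2 := by
  have h5 : (0 : ℝ) < (((3 + 2) * L : ℕ) : ℝ) := by exact_mod_cast (by omega : 0 < (3 + 2) * L)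
  exact div_pos deltaSU_pos (by positivity)

/-- **THE WINDOW THRESHOLD `γw(L, b₀, p₀)`**: a coupling below which `θBal L γ b₀ p₀ i ≤ δ_{SU(2)}/(5L)²` at EVERY height `i`
(`T3ThresholdSmallness.exists_forall_θBal_le`), so that the guard `(((3+2)L)²/4)·θBal < δ_{SU(2)}` of the tree's crude Prop. 1
(`plaqSmall_blockAvg_expMeanLogSU`) holds at every level; `1` for the degenerate `L = 0`. [cite: Balaban1985Averaging, Prop. 1 (51) p.26] -/
def AlphaInputsT3AC.γwOf (L : ℕ) (b₀ p₀ : ℝ) : ℝ :=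
  if hL : 1 ≤ L then
    Classical.choose (exists_forall_θBal_le hL b₀ p₀ (AlphaInputsT3AC.winEps_pos hL))
  else 1

/-- `γw > 0`. [folklore] -/
theorem AlphaInputsT3AC.γwOf_pos (L : ℕ) (b₀ p₀ : ℝ) : 0 < AlphaInputsT3AC.γwOf L b₀ p₀ := by
  unfold AlphaInputsT3AC.γwOf
  split_ifs with hL
  · exact (Classical.choose_spec (exists_forall_θBal_le hL b₀ p₀ (AlphaInputsT3AC.winEps_pos hL))).1
  · exact one_pos

/-- Below `γw` every threshold is `≤ δ_{SU(2)}/(5L)²`. [cite: Balaban1985Averaging, Prop. 1 (51) p.26] -/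
theorem AlphaInputsT3AC.θBal_le_of_le_γwOf {L : ℕ} (hL : 1 ≤ L) (b₀ p₀ : ℝ) {γ : ℝ} (hγ : 0 < γ)
    (hγw : γ ≤ AlphaInputsT3AC.γwOf L b₀ p₀) (i : ℕ) :
    θBal L γ b₀ p₀ i ≤ deltaSU (Fin 2) / (((3 + 2) * L : ℕ) : ℝ) ^ 2 := by
  unfold AlphaInputsT3AC.γwOf at hγw
  rw [dif_pos hL] at hγw
  exact (Classical.choose_spec (exists_forall_θBal_le hL b₀ p₀ (AlphaInputsT3AC.winEps_pos hL))).2 γ hγ hγw i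

/-- Hence the guard of the crude Prop. 1: `(((3+2)L)²/4)·θBal < δ_{SU(2)}`. [cite: Balaban1985Averaging, Prop. 1 (51) p.26] -/
theorem AlphaInputsT3AC.guard_of_le_γwOf {L : ℕ} (hL : 1 ≤ L) (b₀ p₀ : ℝ) {γ : ℝ} (hγ : 0 < γ)
    (hγw : γ ≤ AlphaInputsT3AC.γwOf L b₀ p₀) (i : ℕ) :
    (((3 + 2) * L : ℕ) : ℝ) ^ 2 / 4 * θBal L γ b₀ p₀ i < deltaSU (Fin 2) := by
  have hδ : 0 < deltaSU (Fin 2) := deltaSU_pos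
  have h5 : (0 : ℝ) < (((3 + 2) * L : ℕ) : ℝ) := by exact_mod_cast (by omega : 0 < (3 + 2) * L)
  have hc : 0 < (((3 + 2) * L : ℕ) : ℝ) ^ 2 := by positivity
  have h := AlphaInputsT3AC.θBal_le_of_le_γwOf hL b₀ p₀ hγ hγw i
  calc (((3 + 2) * L : ℕ) : ℝ) ^ 2 / 4 * θBal L γ b₀ p₀ i
      ≤ (((3 + 2) * L : ℕ) : ℝ) ^ 2 / 4 * (deltaSU (Fin 2) / (((3 + 2) * L : ℕ) : ℝ) ^ 2) :=
        mul_le_mul_of_nonneg_left h (by positivity)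
    _ = deltaSU (Fin 2) / 4 := by field_simp
    _ < deltaSU (Fin 2) := by linarith

variable {F : T3Family} {𝔠 : AlphaConsts F.L (suGroupModel 2).N} {a₀ a₁ : ℝ}

/-- **THE WINDOW OF LEVEL `k + 1` OF RUN `K`**: all level-`(k+1)` plaquette variables within `avgWindowFactor(L)·θBal(K − k)` of `1` — the image,
under one `blockAvg ℰp` step, of the `θBal(K − k) = ε₁(k)`-small level-`k` fields ([Balaban1985Averaging] Prop. 1, crude form). [cite: Balaban1985Averaging, Prop. 1 (51) p.26] -/
def AlphaInputsT3AC.windowT3 (F : T3Family) (𝔠 : AlphaConsts F.L (suGroupModel 2).N) (γ : ℝ) (K k : ℕ) :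
    Set (GaugeField (F.P K) (k + 1) (Matrix.specialUnitaryGroup (Fin 2) ℂ)) :=
  {W | PlaqSmall (avgWindowFactor F.L * θBal F.L γ 𝔠.b₀ 𝔠.p₀ (K - k)) W}

/-- The window is measurable. [folklore] -/
theorem AlphaInputsT3AC.measurableSet_windowT3 (F : T3Family) (𝔠 : AlphaConsts F.L (suGroupModel 2).N) (γ : ℝ) (K k : ℕ) :
    MeasurableSet (AlphaInputsT3AC.windowT3 F 𝔠 γ K k) :=
  measurableSet_plaqSmall _

/-- **[Balaban1985Averaging] PROP. 1 AT THE ROUTE'S THRESHOLDS**: for `γ ≤ γw` and `k + 1 ≤ m + K`, a level-`k` field all of whose plaquettes are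
`θBal(K − k)`-small averages (one `blockAvg ℰp` step) into the window (tree `plaqSmall_blockAvg_expMeanLogSU`, `d = 3`). [cite: Balaban1985Averaging, Prop. 1 (51) p.26] -/
theorem AlphaInputsT3AC.blockAvg_mem_windowT3 (F : T3Family) (𝔠 : AlphaConsts F.L (suGroupModel 2).N) {γ : ℝ} (hγ : 0 < γ) (hγ1 : γ ≤ 1)
    (hγw : γ ≤ AlphaInputsT3AC.γwOf F.L 𝔠.b₀ 𝔠.p₀) (K k : ℕ) (hk : k + 1 ≤ F.m + K)
    (U : GaugeField (F.P K) k (Matrix.specialUnitaryGroup (Fin 2) ℂ)) (hU : PlaqSmall (θBal F.L γ 𝔠.b₀ 𝔠.p₀ (K - k)) U) :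
    (BlockAveraging.blockAvg (P := F.P K) (j := k) ℰp).avg U ∈ AlphaInputsT3AC.windowT3 F 𝔠 γ K k := by
  have hL : 1 ≤ F.L := le_of_lt F.hL.2
  have hθ0 : 0 ≤ θBal F.L γ 𝔠.b₀ 𝔠.p₀ (K - k) :=
    (T3MinimiserStabilityReduction.θBal_pos hL hγ hγ1 𝔠.b₀_pos 𝔠.p₀ (K - k)).le
  have hguard := AlphaInputsT3AC.guard_of_le_γwOf hL 𝔠.b₀ 𝔠.p₀ hγ hγw (K - k)
  have h := plaqSmall_blockAvg_expMeanLogSU (n := Fin 2) (P := F.P K) (j := k) hk hθ0 hU hguard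
  show PlaqSmall (avgWindowFactor F.L * θBal F.L γ 𝔠.b₀ 𝔠.p₀ (K - k)) _
  exact h

/-! ## §2 The windowed trivial weight of the v2 datum at given constants -/

section Weight

variable (h : AlphaInputsT3AC.OfV2At F 𝔠 a₀ a₁) (hc : 0 < a₀ ∧ 0 < a₁ ∧ 𝔠.B₃ * a₁ ≤ a₀) (γ : ℝ) (hγ : 0 < γ)
  (hγ1 : γ ≤ (min 𝔠.gamma0 1) ^ 2)

/-- **THE WINDOWED TRIVIAL WEIGHT OF RUN `K` AT LEVEL `j`** for the v2 datum: `1` at `j = 0`; at `j = k + 1` the indicator of the window times the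
RAW transport `T_k[m_k(triv)]` of the package's floored trivial mass over the pinned averaging (`TrivMassAC.trivWt` at the package's tower input).
[cite: Balaban1985UV3, (40)–(41) p.266] -/
def AlphaInputsT3AC.OfV2At.wtW (K j : ℕ) : GaugeField (F.P K) j (Matrix.specialUnitaryGroup (Fin 2) ℂ) → ℝ :=
  trivWt 𝔠.lane.carrier.M₁ (rcolOf (T3Scales F γ hγ (hγ1.trans (sq_min_one_le _ 𝔠.gamma0_pos)) K) 𝔠.lane.carrier)
    (eps1Of (T3Scales F γ hγ (hγ1.trans (sq_min_one_le _ 𝔠.gamma0_pos)) K) 𝔠.lane.carrier)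
    (epsSOf (T3Scales F γ hγ (hγ1.trans (sq_min_one_le _ 𝔠.gamma0_pos)) K) 𝔠.lane.carrier)
    (h.pkgAtV2 hc γ hγ hγ1 K).X.av (AlphaInputsT3AC.windowT3 F 𝔠 γ K) j

/-- `wtW ≥ 0`. [folklore] -/
theorem AlphaInputsT3AC.OfV2At.wtW_nonneg (K j : ℕ) (W : GaugeField (F.P K) j (Matrix.specialUnitaryGroup (Fin 2) ℂ)) :
    0 ≤ h.wtW hc γ hγ hγ1 K j W :=
  trivWt_nonneg _ _ _ _ _ _ j W

/-- **`wtW` IS BELOW THE LANE'S (FLOORED) TRIVIAL WEIGHT**, pointwise, `j ≤ K`: so `up` with `wtW` is below `up_{dataT3c}`. [folklore] -/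
theorem AlphaInputsT3AC.OfV2At.wtW_le_wt_triv (π : AlphaInputsT3AC.PolymerT3 F) (K j : ℕ) (hj : j ≤ K)
    (v : (i : Fin j) → GaugeField (F.P K) i (Matrix.specialUnitaryGroup (Fin 2) ℂ))
    (W : GaugeField (F.P K) j (Matrix.specialUnitaryGroup (Fin 2) ℂ)) :
    h.wtW hc γ hγ hγ1 K j W ≤ (h.lfDataT3c hc γ hγ hγ1 π).wt K j ((h.lfDataT3c hc γ hγ hγ1 π).trivReg K j) v W :=
  trivWt_le_massRecAC _ _ _ _ _ _ j (by show j ≤ F.m + K; omega) W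

/-- `wtW` is measurable. [folklore] -/
theorem AlphaInputsT3AC.OfV2At.measurable_wtW (K j : ℕ) : Measurable (h.wtW hc γ hγ hγ1 K j) :=
  measurable_trivWt _ _ _ _ _ _ (AlphaInputsT3AC.measurableSet_windowT3 F 𝔠 γ K) j

/-- **`wtW` IS INTEGRABLE WITH `∫ wtW K j ≤ max j 1`** (the floors of the lane's chain compound linearly in the level — seat finding F-α1-11: no
cut-off-uniform bound is derivable from the package of record). [folklore] -/
theorem AlphaInputsT3AC.OfV2At.integrable_wtW_and_integral_le (K j : ℕ) :
    Integrable (h.wtW hc γ hγ hγ1 K j) (fieldMeasure (F.P K) j (Matrix.specialUnitaryGroup (Fin 2) ℂ)) ∧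
      ∫ W, h.wtW hc γ hγ hγ1 K j W ∂fieldMeasure (F.P K) j (Matrix.specialUnitaryGroup (Fin 2) ℂ) ≤ max (j : ℝ) 1 :=
  ⟨integrable_trivWt _ _ _ _ _ _ (AlphaInputsT3AC.measurableSet_windowT3 F 𝔠 γ K) j,
    integral_trivWt_le _ _ _ _ _ _ (h.pkgAtV2 hc γ hγ hγ1 K).X.av_ac (AlphaInputsT3AC.measurableSet_windowT3 F 𝔠 γ K) j⟩

/-- **SUPPORT IN PRINT'S (40) WINDOW, POINTWISE, FOR `1 ≤ j ≤ K`**: `wtW K j W ≠ 0 ⇒ Adm K j triv W` for the v2 datum (`Adm = ChargedT3` with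
window factor `avgWindowFactor L`): the trivial history is admissible and `avgWindowFactor·θBal(K − j + 1) ≤ 2L²·avgWindowFactor·θBal(K − j + 1)`.
At `j = 0` no window exists ((41)₀ = (1) p.256; seat finding F-α1-9). [cite: Balaban1985UV3, (40)–(41) p.266] -/
theorem AlphaInputsT3AC.OfV2At.adm_triv_of_wtW_ne_zero (π : AlphaInputsT3AC.PolymerT3 F) (K j : ℕ) (hj1 : 1 ≤ j) (hj : j ≤ K)
    (W : GaugeField (F.P K) j (Matrix.specialUnitaryGroup (Fin 2) ℂ)) (hW : h.wtW hc γ hγ hγ1 K j W ≠ 0) :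
    (h.dataT3c hc γ hγ hγ1 π).Adm K j ((h.dataT3c hc γ hγ hγ1 π).triv K j) W := by
  obtain ⟨k, rfl⟩ : ∃ k, j = k + 1 := ⟨j - 1, by omega⟩
  have hmem : W ∈ AlphaInputsT3AC.windowT3 F 𝔠 γ K k := mem_of_trivWt_succ_ne_zero _ _ _ _ _ _ k W hW
  have hsmall : PlaqSmall (avgWindowFactor F.L * θBal F.L γ 𝔠.b₀ 𝔠.p₀ (K - k)) W := hmem
  refine ⟨Hist.admissible_triv _ _ (k + 1), fun p _ => (hsmall p).trans_le ?_⟩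
  have hKk : K - (k + 1) + 1 = K - k := by omega
  rw [hKk]
  have hγ1' : γ ≤ 1 := hγ1.trans (sq_min_one_le _ 𝔠.gamma0_pos)
  have hθ : 0 ≤ θBal F.L γ 𝔠.b₀ 𝔠.p₀ (K - k) :=
    (T3MinimiserStabilityReduction.θBal_pos (le_of_lt F.hL.2) hγ hγ1' 𝔠.b₀_pos 𝔠.p₀ (K - k)).le
  have hB : 0 ≤ avgWindowFactor F.L := by unfold avgWindowFactor; positivity
  have hL2 : (1 : ℝ) ≤ 2 * (F.L : ℝ) ^ 2 := by
    have hL : (1 : ℝ) ≤ F.L := by exact_mod_cast (le_of_lt F.hL.2)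
    nlinarith
  calc avgWindowFactor F.L * θBal F.L γ 𝔠.b₀ 𝔠.p₀ (K - k)
      = 1 * avgWindowFactor F.L * θBal F.L γ 𝔠.b₀ 𝔠.p₀ (K - k) := by ring
    _ ≤ 2 * (F.L : ℝ) ^ 2 * avgWindowFactor F.L * θBal F.L γ 𝔠.b₀ 𝔠.p₀ (K - k) :=
        mul_le_mul_of_nonneg_right (mul_le_mul_of_nonneg_right hL2 hB) hθ

end Weight

/-! ## §3 The windowed datum: (41′) a.e. and the integrability of its majorant, every `j ≤ K` -/

section Datum

variable (h : AlphaInputsT3AC.OfV2At F 𝔠 a₀ a₁) (hc : 0 < a₀ ∧ 0 < a₁ ∧ 𝔠.B₃ * a₁ ≤ a₀) (γ : ℝ) (hγ : 0 < γ)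
  (hγ1 : γ ≤ (min 𝔠.gamma0 1) ^ 2) (π : AlphaInputsT3AC.PolymerT3 F)

/-- **THE WINDOWED DATUM**: the v2 datum `dataT3c` with its history functional REPLACED by
`Φ ↦ wtW_j(W)·e^{Φ(triv)} + Σ_{r ≠ triv} m_j(r, W)·e^{Φ(r)}` — the structure update STUB 2‴ of line v5p3 writes (regions, minimiser, `mainT`, `Pint`,
`Zterm`, `χ`, `low`, `Rm` unchanged).  A DEFINITION; nothing asserted. [cite: Balaban1985UV3, (40)–(41) p.266] -/
def AlphaInputsT3AC.OfV2At.dataT3cW : AlphaDataT3 F γ :=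
  { h.dataT3c hc γ hγ hγ1 π with
    LF := fun K j Wf Φ => h.wtW hc γ hγ hγ1 K j Wf * Real.exp (Φ (Hist.triv (F.P K) j)) +
      ∑ r ∈ Finset.univ.erase (Hist.triv (F.P K) j), (h.lfDataT3c hc γ hγ hγ1 π).wt K j r (fun _ => 1) Wf * Real.exp (Φ r) }

/-- The windowed majorant unfolded: `up_j(W) = wtW_j(W)·e^{Φ′(triv)} + Σ_{r≠triv} m_j(r,W)·e^{Φ′(r)}`, `Φ′ = −mainT + Pint + Zterm` (definitional).
[cite: Balaban1985UV3, (41) p.266] -/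
theorem AlphaInputsT3AC.OfV2At.dataT3cW_up_eq (K j : ℕ) (W : GaugeField (F.P K) j (Matrix.specialUnitaryGroup (Fin 2) ℂ)) :
    (h.dataT3cW hc γ hγ hγ1 π).up K j W =
      h.wtW hc γ hγ hγ1 K j W * Real.exp (-((h.pkgAtV2 hc γ hγ hγ1 K).T.mainT j (Hist.triv (F.P K) j) W)
          + (h.pkgAtV2 hc γ hγ hγ1 K).T.Pint j (Hist.triv (F.P K) j) W + (h.pkgAtV2 hc γ hγ hγ1 K).T.Zterm j (Hist.triv (F.P K) j)) +
        ∑ r ∈ Finset.univ.erase (Hist.triv (F.P K) j),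
          (inputOfAC 𝔠.lane (h.pkgAtV2 hc γ hγ hγ1 K).X (h.pkgAtV2 hc γ hγ hγ1 K).𝔖).W.mass j r W *
            Real.exp (-((h.pkgAtV2 hc γ hγ hγ1 K).T.mainT j r W) + (h.pkgAtV2 hc γ hγ hγ1 K).T.Pint j r W
              + (h.pkgAtV2 hc γ hγ hγ1 K).T.Zterm j r) := rfl

/-- The lane's majorant unfolded: `up_j(W) = Σ_h m_j(h,W)·e^{Φ′(h)}` (definitional). [cite: Balaban1985UV3, (41) p.266] -/
theorem AlphaInputsT3AC.OfV2At.dataT3c_up_eq_sum (K j : ℕ) (W : GaugeField (F.P K) j (Matrix.specialUnitaryGroup (Fin 2) ℂ)) :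
    (h.dataT3c hc γ hγ hγ1 π).up K j W =
      ∑ r : Hist (F.P K) j, (inputOfAC 𝔠.lane (h.pkgAtV2 hc γ hγ hγ1 K).X (h.pkgAtV2 hc γ hγ hγ1 K).𝔖).W.mass j r W *
        Real.exp (-((h.pkgAtV2 hc γ hγ hγ1 K).T.mainT j r W) + (h.pkgAtV2 hc γ hγ hγ1 K).T.Pint j r W
          + (h.pkgAtV2 hc γ hγ hγ1 K).T.Zterm j r) := rfl

/-- **`0 ≤ up_{windowed} ≤ up_{lane}` POINTWISE**, `j ≤ K` (`wtW ≤ m(triv)`, all masses `≥ 0`). [cite: Balaban1985UV3, (41) p.266] -/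
theorem AlphaInputsT3AC.OfV2At.dataT3cW_up_nonneg_le (K j : ℕ) (hj : j ≤ K) (W : GaugeField (F.P K) j (Matrix.specialUnitaryGroup (Fin 2) ℂ)) :
    0 ≤ (h.dataT3cW hc γ hγ hγ1 π).up K j W ∧ (h.dataT3cW hc γ hγ hγ1 π).up K j W ≤ (h.dataT3c hc γ hγ hγ1 π).up K j W := by
  rw [h.dataT3cW_up_eq hc γ hγ hγ1 π, h.dataT3c_up_eq_sum hc γ hγ hγ1 π,
    ← Finset.add_sum_erase Finset.univ _ (Finset.mem_univ (Hist.triv (F.P K) j))]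
  refine ⟨add_nonneg (mul_nonneg (h.wtW_nonneg hc γ hγ hγ1 K j W) (Real.exp_pos _).le)
      (Finset.sum_nonneg fun r _ => mul_nonneg
        ((inputOfAC 𝔠.lane (h.pkgAtV2 hc γ hγ hγ1 K).X (h.pkgAtV2 hc γ hγ hγ1 K).𝔖).W.mass_nonneg j r W) (Real.exp_pos _).le), ?_⟩
  refine add_le_add (mul_le_mul_of_nonneg_right ?_ (Real.exp_pos _).le) le_rfl
  exact h.wtW_le_wt_triv hc γ hγ hγ1 π K j hj (fun _ => 1) W

end Datum

end Summit.QuantumFields.YangMills.Theorems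

end
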